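/-
b2b-lace packet, ANALYTIC ORACLE seat gen 8 (unit `b2b-lace-oracle-g8`).  The auxiliary SRW integral `V_{n,l}` of
[NoBLE17] §5.2, the half-angle form of `D̂^{sin}`, and the printed Cauchy–Schwarz majorant of `U_{n,l}(x)`.
d-generic; no dimension sentence.
-/
import Literature.Probability.FitznerVanDerHofstad2017.SrwIntegralTU
import HarnessLib

/-!
# `V_{n,l}`, the half-angle form of `D̂^{sin}`, and `U_{n,l}(x) ≤ [V_{n,2l} L_n(x)]^{1/2}`

CITATION HEADER (PLACEMENT v2). Part of a certified REPRODUCTION of R. Fitzner, R. van der Hofstad,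
*Generalized approach to the non-backtracking lace expansion*, Probab. Theory Related Fields 169 (2017)
1041–1119 [NoBLE17] (arXiv:1506.07969), §3.3.3 and §5.2, as consumed by [FvdH17] (EJP 22 no. 43) Prop. 2.2:

> [NoBLE17] §3.3.3 p. 1070: "`D̂^{sin}(k) = d⁻² Σ_s [1 − cos²(k_s)] = 1 − D̂^{cos}(k)`" and the half-angle identity
> `D̂^{sin}(k) = (2d)⁻¹ [1 − D̂(2k)]` (used on p. 1093: "`D̂^{sin}(k)² = (2d)⁻² [1 − D̂(2k)]²`");
> §5.2 (5.8) p. 1091: "`V_{n,l} = ∫ D̂(k)^l [D̂^{sin}(k)]² / [1 − D̂(k)]ⁿ dk/(2π)^d`";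
> (5.9) p. 1091: "We use the Cauchy–Schwarz inequality to bound … `U_{n,l}(x) ≤ [V_{n,2l} L_n(x)]^{1/2}`."

## What is here (definitions transcribed; every bound a kernel theorem; cites are locators)

* `Dsin_eq_half_angle : D̂^{sin}(k) = (1 − D̂(2k))/(2d)` (`sin² t = (1 − cos 2t)/2`);
* `srwV d n l` — (5.8), normalised by `(2π)^d` like the tree's `srwI/srwK/srwL` and `srwT/srwU`; integrability of its
  integrand for `d ≥ 2n+1`; `srwV_even_nonneg : 0 ≤ V_{n,2j}`;
* **`srwU_le_sqrt_srwV_mul_srwL`**: `U_{n,l}(x) ≤ V_{n,2l}^{1/2} L_n(x)^{1/2}` (`d ≥ 2n+1`), by the tree's AM–GM /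
  `λ`-optimisation route (`abs_mul_abs_le_am_gm`, `le_sqrt_mul_sqrt_of_forall` of `SrwIntegralBounds`), exactly as the
  tree proves (5.9) for `K_{n,l}`.

This is the rule by which `SRW.nb` fills the table `U[n,l,v]` at the nodes `v ∉ {0, e₁}` (and, together with
`srwU_single`, at `e₁`); the evaluation (5.25) of `V_{n,l}` in terms of `I_{n,l}` at `0, 2e₁, 2e₁+2e₂, 4e₁` and the
`x = 0` identity (5.13) are not reproduced here (they need the orbit symmetrisation of `SrwIntegralOrbit`).
-/

noncomputable section

open MeasureTheory Real Finset
open scoped BigOperators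

namespace Literature.Probability.FitznerVanDerHofstad2017

open Literature.Barriers.CriticalPhenomena
open Literature.Barriers.CriticalPhenomena.Slade2006Prop53 (P)

variable {d : ℕ}

/-! ### The half-angle form of `D̂^{sin}` -/

/-- `D̂^{sin}(k) = (2d)⁻¹ [1 − D̂(2k)]` (`sin²(t) = (1 − cos 2t)/2`).
[cite: FitznerVanDerHofstad2016NoBLE, §3.3.3 p. 1070 and §5.2 p. 1093 ("D̂^{sin}(k)² = (2d)⁻²[1 − D̂(2k)]²")] -/
theorem Dsin_eq_half_angle (hd : 1 ≤ d) (k : Fin d → ℝ) :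
    Dsin d k = (1 - Dhat d (fun j => 2 * k j)) / (2 * d) := by
  haveI : NeZero d := ⟨by omega⟩
  have hd0 : (d : ℝ) ≠ 0 := by exact_mod_cast (NeZero.ne d)
  rw [one_sub_Dhat, Dsin]
  have hs : ∑ j, Real.sin (k j) ^ 2 = (∑ j, (1 - Real.cos (2 * k j))) / 2 := by
    rw [Finset.sum_div]
    refine Finset.sum_congr rfl fun j _ => ?_
    rw [Real.cos_two_mul, Real.cos_sq' (k j)]
    ring
  rw [hs]
  field_simp

/-! ### `V_{n,l}` ((5.8)), normalised by `(2π)^d` -/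

/-- `V_{n,l} = ∫_{[-π,π]^d} D̂(k)^l [D̂^{sin}(k)]² Ĉ(k)ⁿ dk/(2π)^d`.
[cite: FitznerVanDerHofstad2016NoBLE, (5.8) p. 1091] -/
def srwV (d n l : ℕ) : ℝ :=
  (∫ k, (Dhat d k ^ l * Dsin d k ^ 2) * Chat d 1 k ^ n ∂P d) / (2 * π) ^ d

/-- `D̂^{sin} ≤ 1` (for `d ≥ 1`). [folklore] -/
theorem Dsin_le_one (hd : 1 ≤ d) (k : Fin d → ℝ) : Dsin d k ≤ 1 := by
  have hd0 : (1 : ℝ) ≤ d := by exact_mod_cast hd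
  exact (Dsin_le_inv hd k).trans (by rw [div_le_one (by linarith)]; exact hd0)

/-- The `V`-integrand is integrable for `d ≥ 2n + 1`. [folklore] -/
theorem integrable_srwV_integrand {n : ℕ} (hd : 2 * n + 1 ≤ d) (l : ℕ) :
    Integrable (fun k => (Dhat d k ^ l * Dsin d k ^ 2) * Chat d 1 k ^ n) (P d) := by
  have hd1 : 1 ≤ d := by omega
  refine integrable_weight_mul_Chat_pow hd
    (((continuous_Dhat d).measurable.pow_const l).mul ((continuous_Dsin d).measurable.pow_const 2)) fun k => ?_
  rw [abs_mul, abs_pow, abs_pow, abs_of_nonneg (Dsin_nonneg k)]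
  have h2 : Dsin d k ^ 2 ≤ 1 := pow_le_one₀ (Dsin_nonneg k) (Dsin_le_one hd1 k)
  exact mul_le_one₀ (abs_Dhat_pow_le_one l k) (sq_nonneg _) h2

/-- `V_{n,2j} ≥ 0`. [folklore] -/
theorem srwV_even_nonneg (n j : ℕ) : 0 ≤ srwV d n (2 * j) :=
  div_nonneg (integral_nonneg fun k => mul_nonneg
    (mul_nonneg (by rw [pow_mul]; exact pow_nonneg (sq_nonneg _) j) (sq_nonneg _))
    (pow_nonneg (Chat_one_nonneg k) n)) (two_pi_pow_pos d).le

/-! ### Cauchy–Schwarz against `L_n(x)` ((5.9)) -/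

/-- **(5.9) for `U`: `U_{n,l}(x) ≤ V_{n,2l}^{1/2} L_n(x)^{1/2}`** (`d ≥ 2n + 1`).
[cite: FitznerVanDerHofstad2016NoBLE, (5.9) p. 1091] -/
theorem srwU_le_sqrt_srwV_mul_srwL {n : ℕ} (hd : 2 * n + 1 ≤ d) (l : ℕ) (x : Fin d → ℤ) :
    srwU d n l x ≤ Real.sqrt (srwV d n (2 * l)) * Real.sqrt (srwL d n x) := by
  refine le_sqrt_mul_sqrt_of_forall (srwV_even_nonneg n l) (srwL_nonneg n x) fun lam hl => ?_
  have hA := integrable_srwV_integrand hd (2 * l) (d := d)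
  have hB := integrable_srwL_integrand hd x (n := n)
  have key : ∫ k, (|Dhat d k| ^ l * |DhatSym d x k| * Dsin d k) * Chat d 1 k ^ n ∂P d ≤
      ∫ k, (lam * ((Dhat d k ^ (2 * l) * Dsin d k ^ 2) * Chat d 1 k ^ n) +
        lam⁻¹ * (DhatSym d x k ^ 2 * Chat d 1 k ^ n)) / 2 ∂P d := by
    refine integral_mono_of_nonneg (ae_of_all _ fun k => ?_)
      (((hA.const_mul lam).add (hB.const_mul lam⁻¹)).div_const 2) (ae_of_all _ fun k => ?_)
    · exact mul_nonneg (mul_nonneg (mul_nonneg (pow_nonneg (abs_nonneg _) l) (abs_nonneg _)) (Dsin_nonneg k))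
        (pow_nonneg (Chat_one_nonneg k) n)
    · have h := abs_mul_abs_le_am_gm (Dhat d k ^ l * Dsin d k) (DhatSym d x k) hl
      have hC := pow_nonneg (Chat_one_nonneg k) n
      have h2 := mul_le_mul_of_nonneg_right h hC
      rw [abs_mul, abs_pow, abs_of_nonneg (Dsin_nonneg k)] at h2
      have e1 : |Dhat d k| ^ l * |DhatSym d x k| * Dsin d k = |Dhat d k| ^ l * Dsin d k * |DhatSym d x k| := by
        ring
      show |Dhat d k| ^ l * |DhatSym d x k| * Dsin d k * Chat d 1 k ^ n ≤
        (lam * ((Dhat d k ^ (2 * l) * Dsin d k ^ 2) * Chat d 1 k ^ n) +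
          lam⁻¹ * (DhatSym d x k ^ 2 * Chat d 1 k ^ n)) / 2
      rw [e1]
      refine h2.trans (le_of_eq ?_)
      ring
  have e : ∫ k, (lam * ((Dhat d k ^ (2 * l) * Dsin d k ^ 2) * Chat d 1 k ^ n) +
        lam⁻¹ * (DhatSym d x k ^ 2 * Chat d 1 k ^ n)) / 2 ∂P d =
      (lam * (∫ k, (Dhat d k ^ (2 * l) * Dsin d k ^ 2) * Chat d 1 k ^ n ∂P d) +
        lam⁻¹ * ∫ k, DhatSym d x k ^ 2 * Chat d 1 k ^ n ∂P d) / 2 := by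
    rw [integral_div, integral_add (hA.const_mul lam) (hB.const_mul lam⁻¹), integral_const_mul,
      integral_const_mul]
  unfold srwU srwV srwL
  calc (∫ k, (|Dhat d k| ^ l * |DhatSym d x k| * Dsin d k) * Chat d 1 k ^ n ∂P d) / (2 * π) ^ d
      ≤ ((lam * (∫ k, (Dhat d k ^ (2 * l) * Dsin d k ^ 2) * Chat d 1 k ^ n ∂P d) +
          lam⁻¹ * ∫ k, DhatSym d x k ^ 2 * Chat d 1 k ^ n ∂P d) / 2) / (2 * π) ^ d :=
        div_le_div_of_nonneg_right (key.trans_eq e) (two_pi_pow_pos d).le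
    _ = _ := by ring

end Literature.Probability.FitznerVanDerHofstad2017
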